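/-
Copyright (c) 2026. All rights reserved.
Released under Apache 2.0 license as described in the file LICENSE.
Authors: abc-iut cell — seat abc-iut-w4-d104 (gen 3): row «SUBDAG-AbsTopIII-Cor-29 (a) at the disc CHART model»
(L4-lead RULING #6c), over abc-iut-w5-d225's typed sub-DAG statements (p414208) and plane model (p414668).
-/
import Literature.AnabelianGeometry.AbsoluteAnabelian.ArchimedeanReconstructionCor29ModelProofs
import Literature.AnabelianGeometry.AbsoluteAnabelian.ArchimedeanReconstructionOrthogonalFramesProofs
import HarnessLib

/-!
# [AbsTopIII] Cor 2.9 (a) at the disc CHART model: the local additive structure transported by a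
# holomorphic chart, its division maps, the limits `lim n · f((1/n)·ₓ v⃗)`, the functional `ι_{U_X,x}`

S. Mochizuki, *Topics in absolute anabelian geometry III* (bib key `MochizukiAbsTopIII2015`), Cor 2.9 (a),
kurims pp.64–65 (paraphrase): for an NF-point `x` and `v⃗` in a sufficiently small neighbourhood `U_X` of `x`
admitting the local additive structure of Cor 2.7 (c), the assignment
`(v⃗, f) ↦ lim_{n → ∞} n · f((1/n) ·ₓ v⃗)` depends only on `df|_x` and determines a topological embedding
`ι_{U_X,x} : U_X ↪ Hom_{k_v}(ω_x, k_v)` compatible with the local additive structures.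

The sub-DAG `plan/L4/SUBDAG-AbsTopIII-Cor-29.md` (holder abc-iut-w5-d225) TYPED rows a.r1–a.r6 as the
generic statements `AR.Cor29.IsLocalAddDatumAt / LimitExists / IotaComputesLimits / IotaIsEmbedding /
IotaAdditive / AdmitsLocalAddNbhd` (p414208) and PROVED them at the PLANE model (identity chart:
`a +ₓ b = a + b − x`, p414668).  Print's local additive structure on `X^top` is TRANSPORTED from `E^top`
through holomorphic local coordinates (row 0.r3), i.e. in a planar picture it is the CONJUGATE of vector
addition by a biholomorphic chart.  This PROOF-ONLY file (no definitions; the data are passed to the typed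
statements as explicit lambdas) proves the same rows for that transported structure: `V ⊆ ℂ` an
Aut-holomorphic disc with a planar chart `(e, e')` centred at `x` (the hypothesis package of
`ArchimedeanReconstructionStabilizerRotationsProofs`; produced from `IsAutHolDisc ↥V` by
`exists_planarChart_centered`), `a +ₓ b := e⁻¹(e a + e b)`, `(1/n)·ₓ v := e⁻¹(e v / n)`, functions
`f : ℂ → ℂ` differentiable at `x` with `f x = 0`, `df|_x := f′(x)`, `ι(v) := ((e⁻¹)′(0) · e v) • id`:

* `isLocalAddDatumAt_chart` (a.r1, CM0) — on `U_X = {v ∈ V | ‖e v‖ < 1/2}`: origin laws, continuity,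
  `(1/n)·ₓ U_X ⊆ U_X`, and the `n`-fold `+ₓ`-iterate of `(1/n)·ₓ v` from `x` is `v`;
* `tendsto_nat_mul_apply_chartScale` (a.r2, CM1) — `n · f(e⁻¹(e v/n)) ⟶ f′(x) · (e⁻¹)′(0) · e v`
  (w5-d225's Taylor limit `Cor29Model.tendsto_nat_mul_apply_scale` applied to `f ∘ e⁻¹` at `0`);
* `iotaComputesLimits_chart`, `limitExists_chart` (a.r2–a.r4, CM2/CM3) — `ι` computes the limits, which
  therefore exist and depend only on `df|_x`;
* `iotaIsEmbedding_chart` (a.r5, CM4) — `ι` is a topological embedding on every `U ⊆ V`;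
* `iotaAdditive_chart` (a.r6, CM5) — `ι(a +ₓ b) = ι a + ι b`, `n • ι((1/n)·ₓ v) = ι v` on `U_X`;
* `admitsLocalAddNbhd_chart` (a.r1 for every `x ∈ V`, CM6) — by Möbius re-centring (`chart_discMobius`).

Rows (b) (scalar of `𝒜_x`, field isomorphism, compatibility with `𝒜_{x₁} ⥲ 𝒜_{x₂}`) need the TRANSPORTED
local linear holomorphic structure (a definition) and are not in this file.  HONEST SCOPE: model level;
refereed pre-IUT material; nothing here bears on the disputed [IUTchIII] Cor. 3.12; typed ≠ endorsed.
-/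

noncomputable section

namespace Literature.AnabelianGeometry.AbsoluteAnabelian

open _root_.Complex _root_.Set _root_.Topology _root_.Filter _root_.Metric _root_.Function
open Literature.Analysis.Complex ArchimedeanReconstruction ArchimedeanReconstruction.Cor29

namespace ArchimedeanReconstruction.Cor29ChartModel

variable {V : Set ℂ} {e e' : ℂ → ℂ}

/-! ### Bookkeeping in the chart -/

/-- `‖w / n‖ ≤ ‖w‖` for `n ≥ 1`, so the divided vectors stay in any ball around `0`.
[cite: MochizukiAbsTopIII2015, Corollary 2.9 (a) p.65] -/
theorem norm_div_nat_le (w : ℂ) {n : ℕ} (hn : 0 < n) : ‖w / (n : ℂ)‖ ≤ ‖w‖ := by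
  rw [norm_div, Complex.norm_natCast]
  exact div_le_self (norm_nonneg _) (by exact_mod_cast hn)

/-- `w / n` lies in the unit ball when `w` does (`n ≥ 1`). [cite: MochizukiAbsTopIII2015, Corollary 2.9 (a) p.65] -/
theorem div_nat_mem_ball {w : ℂ} (hw : w ∈ ball (0 : ℂ) 1) {n : ℕ} (hn : 0 < n) :
    w / (n : ℂ) ∈ ball (0 : ℂ) 1 := by
  rw [mem_ball_zero_iff] at hw ⊢
  exact (norm_div_nat_le w hn).trans_lt hw

/-- `k • (w / n)` lies in the unit ball for `k ≤ n`, `n ≥ 1`, `w` in the ball.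
[cite: MochizukiAbsTopIII2015, Corollary 2.9 (a) p.65] -/
theorem nat_mul_div_nat_mem_ball {w : ℂ} (hw : w ∈ ball (0 : ℂ) 1) {k n : ℕ} (hn : 0 < n) (hk : k ≤ n) :
    (k : ℂ) * (w / (n : ℂ)) ∈ ball (0 : ℂ) 1 := by
  rw [mem_ball_zero_iff] at hw ⊢
  have hn' : (0 : ℝ) < n := by exact_mod_cast hn
  have hkn : (k : ℝ) / n ≤ 1 := by
    rw [div_le_one hn']; exact_mod_cast hk
  calc ‖(k : ℂ) * (w / (n : ℂ))‖ = (k : ℝ) / n * ‖w‖ := by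
        rw [norm_mul, norm_div, Complex.norm_natCast, Complex.norm_natCast]; ring
    _ ≤ 1 * ‖w‖ := by gcongr
    _ < 1 := by rw [one_mul]; exact hw

/-! ### Row a.r1 (CM0): the transported local additive structure and its division maps -/

/-- **Row Cor-29.a.r1 at the chart model**: for a planar chart `(e, e')` of `V` centred at `x`, the
TRANSPORTED local additive structure `a +ₓ b := e⁻¹(e a + e b)` with division maps
`(1/n)·ₓ v := e⁻¹(e v / n)` is a local additive datum at `x` on the neighbourhood
`U_X = {v ∈ V | ‖e v‖ < 1/2}` (origin laws, continuity, `(1/n)·ₓ U_X ⊆ U_X`, and the `n`-fold `+ₓ`-iterate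
of `(1/n)·ₓ v` from `x` is `v`). [cite: MochizukiAbsTopIII2015, Corollary 2.9 (a) pp.64–65] -/
theorem isLocalAddDatumAt_chart (hV : IsOpen V) (he : DifferentiableOn ℂ e V)
    (he' : DifferentiableOn ℂ e' (ball 0 1)) (he'm : MapsTo e' (ball 0 1) V)
    (hl : ∀ z ∈ V, e' (e z) = z) (hr : ∀ w ∈ ball (0 : ℂ) 1, e (e' w) = w) {x : ℂ} (hx : x ∈ V)
    (hex : e x = 0) :
    IsLocalAddDatumAt (fun a b => e' (e a + e b)) (fun n v => e' (e v / (n : ℂ))) x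
      {v | v ∈ V ∧ ‖e v‖ < 1 / 2} := by
  have he'0 : e' 0 = x := by rw [← hex]; exact hl x hx
  have hhalf : ∀ {w : ℂ}, ‖w‖ < 1 / 2 → w ∈ ball (0 : ℂ) 1 := fun hw => by
    rw [mem_ball_zero_iff]; linarith
  have hUopen : IsOpen {v | v ∈ V ∧ ‖e v‖ < 1 / 2} := by
    have h := he.continuousOn.isOpen_inter_preimage hV (isOpen_ball (x := (0 : ℂ)) (ε := 1 / 2))
    convert h using 1
    ext v
    simp
  refine ⟨hUopen, ⟨hx, by rw [hex, norm_zero]; norm_num⟩, fun b hb => ?_, fun a ha => ?_, ?_, fun n hn => ?_,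
    fun n hn => ?_, fun n hn v hv => ?_⟩
  · show e' (e x + e b) = b
    rw [hex, zero_add, hl b hb.1]
  · show e' (e a + e x) = a
    rw [hex, add_zero, hl a ha.1]
  · -- continuity of `(a, b) ↦ e⁻¹(e a + e b)` on `U × U`
    have h1 : ContinuousOn (fun q : ℂ × ℂ => e q.1 + e q.2) ({v | v ∈ V ∧ ‖e v‖ < 1 / 2} ×ˢ {v | v ∈ V ∧ ‖e v‖ < 1 / 2}) :=
      (he.continuousOn.comp continuous_fst.continuousOn fun q hq => (mem_prod.1 hq).1.1).add
        (he.continuousOn.comp continuous_snd.continuousOn fun q hq => (mem_prod.1 hq).2.1)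
    refine he'.continuousOn.comp h1 fun q hq => ?_
    obtain ⟨⟨-, h1'⟩, ⟨-, h2'⟩⟩ := mem_prod.1 hq
    rw [mem_ball_zero_iff]
    calc ‖e q.1 + e q.2‖ ≤ ‖e q.1‖ + ‖e q.2‖ := norm_add_le _ _
      _ < 1 / 2 + 1 / 2 := add_lt_add h1' h2'
      _ = 1 := by norm_num
  · -- `(1/n)·ₓ` maps `U` into `U`
    intro v hv
    have hw : e v / (n : ℂ) ∈ ball (0 : ℂ) 1 := div_nat_mem_ball (hhalf hv.2) hn
    refine ⟨he'm hw, ?_⟩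
    show ‖e (e' (e v / (n : ℂ)))‖ < 1 / 2
    rw [hr _ hw]
    exact (norm_div_nat_le _ hn).trans_lt hv.2
  · -- continuity of `(1/n)·ₓ` on `U`
    refine he'.continuousOn.comp ((he.continuousOn.mono fun v hv => hv.1).div_const _) fun v hv => ?_
    exact div_nat_mem_ball (hhalf hv.2) hn
  · -- the `n`-fold `+ₓ`-iterate of `w = (1/n)·ₓ v` from `x` is `v`
    have hw : e v / (n : ℂ) ∈ ball (0 : ℂ) 1 := div_nat_mem_ball (hhalf hv.2) hn
    have hiter : ∀ k : ℕ, k ≤ n →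
        (fun b => e' (e (e' (e v / (n : ℂ))) + e b))^[k] x = e' ((k : ℂ) * (e v / (n : ℂ))) := by
      intro k hk
      induction k with
      | zero => simp [he'0]
      | succ k ih =>
        rw [Function.iterate_succ_apply', ih (Nat.le_of_succ_le hk), hr _ hw,
          hr _ (nat_mul_div_nat_mem_ball (hhalf hv.2) hn (Nat.le_of_succ_le hk))]
        congr 1; push_cast; ring
    show (fun b => e' (e (e' (e v / (n : ℂ))) + e b))^[n] x = v
    rw [hiter n le_rfl]
    have hn' : (n : ℂ) ≠ 0 := by exact_mod_cast hn.ne'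
    rw [mul_div_cancel₀ _ hn', hl v hv.1]

/-! ### Rows a.r2–a.r4 (CM1–CM3): the limit in the chart -/

/-- **Row Cor-29.a.r2 at the chart model (CM1)**: for `f` differentiable at `x` with `f x = 0`,
`n · f((1/n)·ₓ v) = n · f(e⁻¹(e v / n)) ⟶ f′(x) · (e⁻¹)′(0) · e(v)` (w5-d225's Taylor limit applied to
`f ∘ e⁻¹` at `0`). [cite: MochizukiAbsTopIII2015, Corollary 2.9 (a) p.65] -/
theorem tendsto_nat_mul_apply_chartScale (he' : DifferentiableOn ℂ e' (ball 0 1))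
    (hl : ∀ z ∈ V, e' (e z) = z) {x : ℂ} (hx : x ∈ V) (hex : e x = 0)
    {f : ℂ → ℂ} (hf : DifferentiableAt ℂ f x) (hfx : f x = 0) (v : ℂ) :
    Tendsto (fun n : ℕ => (n : ℂ) * f (e' (e v / (n : ℂ)))) atTop
      (𝓝 (deriv f x * deriv e' 0 * e v)) := by
  have he'0 : e' 0 = x := by rw [← hex]; exact hl x hx
  have hde' : DifferentiableAt ℂ e' 0 := he'.differentiableAt (isOpen_ball.mem_nhds (mem_ball_self one_pos))
  have hf' : DifferentiableAt ℂ f (e' 0) := by rw [he'0]; exact hf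
  have hcomp : HasDerivAt (fun w => f (e' w)) (deriv f x * deriv e' 0) 0 := by
    have h := hf'.hasDerivAt.comp 0 hde'.hasDerivAt
    rw [he'0] at h
    exact h
  have h0 : (fun w => f (e' w)) 0 = 0 := by simp only [he'0, hfx]
  have h := Cor29Model.tendsto_nat_mul_apply_scale 0 hcomp h0 (e v)
  simp only [Cor29Model.scale_apply, zero_add, sub_zero] at h
  convert h using 2

/-- **Rows Cor-29.a.r3/a.r4 at the chart model (CM2/CM3)**: the functional
`ι(v) = ((e⁻¹)′(0) · e v) • id` COMPUTES the limits for every `f` differentiable at `x` vanishing at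
`x`, on every `U ⊆ V`; so the limits exist and depend only on `df|_x = f′(x)` (Cor29 generic lemmas).
[cite: MochizukiAbsTopIII2015, Corollary 2.9 (a) p.65] -/
theorem iotaComputesLimits_chart (he' : DifferentiableOn ℂ e' (ball 0 1))
    (hl : ∀ z ∈ V, e' (e z) = z) {x : ℂ} (hx : x ∈ V) (hex : e x = 0) (U : Set ℂ) :
    IotaComputesLimits (fun (f : ℂ → ℂ) v => f v) (fun f => f x = 0 ∧ DifferentiableAt ℂ f x)
      (fun f => deriv f x) (fun n v => e' (e v / (n : ℂ))) U
      (fun v => (deriv e' 0 * e v) • (LinearMap.id : ℂ →ₗ[ℂ] ℂ)) := by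
  intro v _ f hf
  have h := tendsto_nat_mul_apply_chartScale he' hl hx hex hf.2 hf.1 v
  simp only [LinearMap.smul_apply, LinearMap.id_apply, smul_eq_mul]
  convert h using 2
  ring

/-- Rows a.r2/a.r3 as corollaries: the limits EXIST and depend only on `f′(x)`.
[cite: MochizukiAbsTopIII2015, Corollary 2.9 (a) p.65] -/
theorem limitExists_chart (he' : DifferentiableOn ℂ e' (ball 0 1))
    (hl : ∀ z ∈ V, e' (e z) = z) {x : ℂ} (hx : x ∈ V) (hex : e x = 0) (U : Set ℂ) :
    LimitExists (fun (f : ℂ → ℂ) v => f v) (fun f => f x = 0 ∧ DifferentiableAt ℂ f x)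
      (fun n v => e' (e v / (n : ℂ))) U :=
  limitExists_of_iotaComputesLimits (iotaComputesLimits_chart he' hl hx hex U)

/-! ### Rows a.r5/a.r6 (CM4/CM5): embedding and additivity -/

/-- **Row Cor-29.a.r5 at the chart model (CM4)**: `v ↦ ι(v)` is a topological EMBEDDING of every
`U ⊆ V` (composing with evaluation at `dz ↦ 1` gives `v ↦ (e⁻¹)′(0) · e v`, an embedding because `e` is a
chart of `V` and `(e⁻¹)′(0) ≠ 0`). [cite: MochizukiAbsTopIII2015, Corollary 2.9 (a) p.65] -/
theorem iotaIsEmbedding_chart (hV : IsOpen V) (he : DifferentiableOn ℂ e V)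
    (hem : MapsTo e V (ball 0 1)) (he' : DifferentiableOn ℂ e' (ball 0 1))
    (hl : ∀ z ∈ V, e' (e z) = z) {x : ℂ} (hx : x ∈ V) (hex : e x = 0) {U : Set ℂ} (hU : U ⊆ V) :
    IotaIsEmbedding U (fun v => (deriv e' 0 * e v) • (LinearMap.id : ℂ →ₗ[ℂ] ℂ)) := by
  unfold IotaIsEmbedding
  have hd : deriv e' 0 ≠ 0 := by
    have h := chart_deriv_symm_ne_zero hV he hem he' hl hx
    rwa [hex] at h
  -- the map `g : v ↦ (deriv e' 0) · e v` on `U` is a homeomorphism onto its image (inverse `w ↦ e⁻¹(w / d)`)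
  set d : ℂ := deriv e' 0 with hd'
  have hcontg : Continuous (fun v : U => d * e (v : ℂ)) :=
    continuous_const.mul ((he.continuousOn.mono hU).comp_continuous continuous_subtype_val fun v => v.2)
  have hginj : Function.Injective (fun v : U => d * e (v : ℂ)) := by
    intro v w hvw
    apply Subtype.ext
    have h1 : e (v : ℂ) = e (w : ℂ) := mul_left_cancel₀ hd hvw
    rw [← hl _ (hU v.2), ← hl _ (hU w.2), h1]
  let H : U ≃ Set.range (fun v : U => d * e (v : ℂ)) := Equiv.ofInjective _ hginj
  have hHcont : Continuous H := by
    have h : Continuous (fun v : U => (⟨d * e (v : ℂ), Set.mem_range_self v⟩ :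
        Set.range (fun v : U => d * e (v : ℂ)))) := hcontg.subtype_mk _
    refine h.congr fun v => ?_
    exact Subtype.ext (by simp [H, Equiv.ofInjective_apply])
  have hHsymm : Continuous H.symm := by
    -- `H.symm w = e⁻¹(w / d)` : continuous because `e⁻¹` is continuous on the ball ∋ `w / d`
    have hformula : ∀ w : Set.range (fun v : U => d * e (v : ℂ)), ((H.symm w : U) : ℂ) = e' ((w : ℂ) / d) := by
      intro w
      obtain ⟨v, hv⟩ := w.2
      have hw : H.symm w = v := by
        apply H.injective
        rw [Equiv.apply_symm_apply]
        exact Subtype.ext hv.symm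
      rw [hw, ← hv]
      show (v : ℂ) = e' (d * e (v : ℂ) / d)
      rw [mul_div_cancel_left₀ _ hd, hl _ (hU v.2)]
    have h1 : Continuous (fun w : Set.range (fun v : U => d * e (v : ℂ)) => e' ((w : ℂ) / d)) := by
      refine he'.continuousOn.comp_continuous (continuous_subtype_val.div_const d) fun w => ?_
      obtain ⟨v, hv⟩ := w.2
      rw [← hv]
      show d * e (v : ℂ) / d ∈ ball (0 : ℂ) 1
      rw [mul_div_cancel_left₀ _ hd]
      exact hem (hU v.2)
    have h2 : Continuous (fun w : Set.range (fun v : U => d * e (v : ℂ)) => ((H.symm w : U) : ℂ)) := by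
      simp only [hformula]; exact h1
    exact continuous_induced_rng.2 h2
  let Hh : U ≃ₜ Set.range (fun v : U => d * e (v : ℂ)) :=
    { H with continuous_toFun := hHcont, continuous_invFun := hHsymm }
  have hemb : IsEmbedding (fun v : U => d * e (v : ℂ)) := by
    have : (fun v : U => d * e (v : ℂ)) = Subtype.val ∘ Hh := by
      funext v; rfl
    rw [this]
    exact IsEmbedding.subtypeVal.comp Hh.isEmbedding
  have hcont : Continuous (fun v : U => fun ω : ℂ => ((deriv e' 0 * e (v : ℂ)) • (LinearMap.id : ℂ →ₗ[ℂ] ℂ)) ω) := by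
    refine continuous_pi fun ω => ?_
    simp only [LinearMap.smul_apply, LinearMap.id_apply, smul_eq_mul]
    exact hcontg.mul continuous_const
  have hev : Continuous (fun g : ℂ → ℂ => g 1) := continuous_apply 1
  have hcomp : (fun g : ℂ → ℂ => g 1) ∘
      (fun v : U => fun ω : ℂ => ((deriv e' 0 * e (v : ℂ)) • (LinearMap.id : ℂ →ₗ[ℂ] ℂ)) ω) =
      fun v : U => d * e (v : ℂ) := by
    funext v
    simp [hd']
  exact IsEmbedding.of_comp hcont hev (hcomp ▸ hemb)

/-- **Row Cor-29.a.r6 at the chart model (CM5)**: `ι` is compatible with the TRANSPORTED local additive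
structure: `ι(a +ₓ b) = ι(a) + ι(b)` whenever `a, b ∈ U_X = {‖e ·‖ < 1/2}`, and `n • ι((1/n)·ₓ v) = ι(v)`.
[cite: MochizukiAbsTopIII2015, Corollary 2.9 (a) p.65] -/
theorem iotaAdditive_chart (hr : ∀ w ∈ ball (0 : ℂ) 1, e (e' w) = w) :
    IotaAdditive (𝕜 := ℂ) (fun a b => e' (e a + e b)) (fun n v => e' (e v / (n : ℂ)))
      {v | v ∈ V ∧ ‖e v‖ < 1 / 2} (fun v => (deriv e' 0 * e v) • (LinearMap.id : ℂ →ₗ[ℂ] ℂ)) := by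
  refine ⟨fun a ha b hb _ => ?_, fun n hn v hv => ?_⟩
  · have hab : e a + e b ∈ ball (0 : ℂ) 1 := by
      rw [mem_ball_zero_iff]
      calc ‖e a + e b‖ ≤ ‖e a‖ + ‖e b‖ := norm_add_le _ _
        _ < 1 / 2 + 1 / 2 := add_lt_add ha.2 hb.2
        _ = 1 := by norm_num
    refine LinearMap.ext fun ω => ?_
    simp only [LinearMap.smul_apply, LinearMap.id_apply, LinearMap.add_apply, smul_eq_mul, hr _ hab]
    ring
  · have hn' : (n : ℂ) ≠ 0 := by exact_mod_cast hn.ne'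
    have hw : e v / (n : ℂ) ∈ ball (0 : ℂ) 1 := by
      have : e v ∈ ball (0 : ℂ) 1 := by rw [mem_ball_zero_iff]; linarith [hv.2]
      exact div_nat_mem_ball this hn
    refine LinearMap.ext fun ω => ?_
    simp only [LinearMap.smul_apply, LinearMap.id_apply, smul_eq_mul, hr _ hw]
    field_simp

/-- **Row Cor-29.a.r1 for EVERY point of `V` (CM6)**: re-centring the chart at `x ∈ V` by the Möbius map
`φ_{e x}` (`chart_discMobius`), every point of the Aut-holomorphic disc `V` has a neighbourhood carrying the
transported local additive structure at that point — `AdmitsLocalAddNbhd` with `isNFPoint := (· ∈ V)`.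
[cite: MochizukiAbsTopIII2015, Corollary 2.9 (a) pp.64–65] -/
theorem admitsLocalAddNbhd_chart (hV : IsOpen V) (he : DifferentiableOn ℂ e V) (hem : MapsTo e V (ball 0 1))
    (he' : DifferentiableOn ℂ e' (ball 0 1)) (he'm : MapsTo e' (ball 0 1) V)
    (hl : ∀ z ∈ V, e' (e z) = z) (hr : ∀ w ∈ ball (0 : ℂ) 1, e (e' w) = w) :
    AdmitsLocalAddNbhd (fun x => x ∈ V)
      (fun x a b => e' (discMobius (-e x) (discMobius (e x) (e a) + discMobius (e x) (e b))))
      (fun x n v => e' (discMobius (-e x) (discMobius (e x) (e v) / (n : ℂ)))) := by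
  intro x hx
  have ha : ‖e x‖ < 1 := mem_ball_zero_iff.1 (hem hx)
  obtain ⟨hea, heam, hea', hea'm, hla, hra⟩ := chart_discMobius he hem he' he'm hl hr ha
  exact ⟨_, isLocalAddDatumAt_chart (e := fun z => discMobius (e x) (e z))
    (e' := fun w => e' (discMobius (-e x) w)) hV hea hea' hea'm hla hra hx (discMobius_self _)⟩

end ArchimedeanReconstruction.Cor29ChartModel

end Literature.AnabelianGeometry.AbsoluteAnabelian

end
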